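import Literature.Computability.Complexity.StringCopy
import HarnessLib

/-!
# Swapping a pair, `⟨a, b⟩ ↦ ⟨b, a⟩`, is polynomial time; `mapSnd` (trunk CplxCore)

Companion of `StringCopy.lean`, built the same way from the `FinTM2` toolkit (transducers,
`PolyTimeComputable.iterate_of_le_add`, `initFn`, `rePair`) without programming a new machine:

* `swapFn ∈ FP` with `swapFn (boolPair a b) = boolPair b a` (`swapFn_boolPair`): end-mark the input
  `z = ⟨a, b⟩` as `⟨z, []⟩ = a⁴ 0011 b² 01` (`rePair ∘ dup`), prefix the clock `1^{|z|}` (`initFn`),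
  recode (`swapInit`: cells `1c` for the symbols of `a`, a marker `0`, cells `10c` for the symbols
  of `b`, the end marker `0`), run `|z| ≥ |a|` rounds of `swapStep` (move the first remaining
  `a`-cell in front of the end marker, as a cell `11c`), decode (`swapOut`);
* `mapSndFn f := swapFn ∘ mapFstFn f ∘ swapFn ∈ FP` for `f ∈ FP`, with
  `mapSndFn f (boolPair a b) = boolPair a (f b)` (`MapFstMachine.lean` gives the first component).

## References

* S. Arora, B. Barak, *Computational Complexity: A Modern Approach*, CUP 2009, §0.1, §1.3, §1.4.1,
  Thm. 2.8.
-/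

namespace Literature.Computability.Complexity

open _root_.Computability StrCopy

namespace StrSwap

/-! ### Configurations of the swap loop -/

/-- The loop configuration: remaining `a`-symbols as cells `1c`, the marker `0`, the `b`-symbols as
cells `10c`, the moved `a`-symbols as cells `11c`, the end marker `0`. [folklore] -/
def cfg (rest b moved : List Bool) : List Bool :=
  (rest.flatMap fun c => [true, c]) ++ false ::
    ((b.flatMap fun c => [true, false, c]) ++ (moved.flatMap fun c => [true, true, c]) ++ [false])

/-! ### Stage 2: recoding, `swapInit` -/

/-- States of `swapInit`: clock conversion, block terminator, the quadruple reader over `a⁴`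
(`q0`–`q3`, `sep`), the pair reader over `b²` (`p0`, `p1`), and the final state. [folklore] -/
inductive S₂
  | cnt
  | z1
  | q0
  | q1 (c : Bool)
  | q2 (c : Bool)
  | q3 (c : Bool)
  | sep
  | p0
  | p1 (c : Bool)
  | fin
  deriving DecidableEq, Fintype

/-- Transition function of `swapInit`. [folklore] -/
def swapInitStep : S₂ → Bool → S₂ × List (Option Bool)
  | .cnt, true => (.cnt, [none])
  | .cnt, false => (.z1, [])
  | .z1, true => (.z1, [])
  | .z1, false => (.q0, [])
  | .q0, c => (.q1 c, [])
  | .q1 c, c' => (if c' = c then .q2 c else .fin, [])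
  | .q2 c, c' => (if c' = c then .q3 c else if (c = false ∧ c' = true) then .sep else .fin, [])
  | .q3 c, c' => (if c' = c then .q0 else .fin, if c' = c then [some true, some c] else [])
  | .sep, true => (.p0, [some false])
  | .sep, false => (.fin, [])
  | .p0, c => (.p1 c, [])
  | .p1 c, c' => (if c' = c then .p0 else .fin,
      if c' = c then [some true, some false, some c] else if c = false then [some false] else [])
  | .fin, _ => (.fin, [])

/-- The recoding transducer `1ⁿ 0 0 (a⁴ 0011 b² 01) ↦ noneⁿ ++ (cfg a b []).map some`. [folklore] -/
def swapInit : FST S₂ Bool (Option Bool) where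
  init := .cnt
  step := swapInitStep
  front := fun _ => []
  keep := fun _ => true

/-- The transition of `swapInit` (definitional). [folklore] -/
@[simp] theorem swapInit_step (s : S₂) (b : Bool) : swapInit.step s b = swapInitStep s b := rfl

/-- The body emitted from state `p0`, as a plain function. [folklore] -/
def pPart : List Bool → List Bool
  | c :: c' :: w => if c' = c then true :: false :: c :: pPart w else if c = false then [false] else []
  | _ => []

/-- The body emitted from state `q0`, as a plain function. [folklore] -/
def qPart : List Bool → List Bool
  | c₁ :: c₂ :: c₃ :: c₄ :: w =>
    if c₂ = c₁ then
      (if c₃ = c₁ then (if c₄ = c₁ then true :: c₁ :: qPart w else [])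
        else if (c₁ = false ∧ c₃ = true) then (if c₄ = true then false :: pPart w else []) else [])
    else []
  | _ => []

/-- The body emitted from state `z1`, as a plain function. [folklore] -/
def z1Part : List Bool → List Bool
  | true :: w => z1Part w
  | false :: w => qPart w
  | [] => []

/-- Payload/count decomposition of the output of `swapInit` on an arbitrary input. [folklore] -/
def stage2 (w : List Bool) : List Bool × ℕ :=
  (z1Part (splitOnes w).2, (splitOnes w).1)

/-- From `fin` nothing is emitted. [folklore] -/
theorem run_fin (w : List Bool) : (swapInit.run .fin w).2 = [] := by
  induction w with
  | nil => rfl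
  | cons b w ih => simp [FST.run_cons, swapInitStep, ih]

/-- From `p0` the transducer emits `(pPart w).map some`. [folklore] -/
theorem run_p0 : ∀ w : List Bool, (swapInit.run .p0 w).2 = (pPart w).map some
  | [] => rfl
  | [c] => by simp [FST.run_cons, swapInitStep, pPart]
  | c :: c' :: w => by
    by_cases h : c' = c
    · subst h; simp [FST.run_cons, swapInitStep, pPart, run_p0 w]
    · cases c <;> simp [FST.run_cons, swapInitStep, pPart, h, run_fin]

/-- From `q0` the transducer emits `(qPart w).map some`. [folklore] -/
theorem run_q0 : ∀ w : List Bool, (swapInit.run .q0 w).2 = (qPart w).map some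
  | [] => rfl
  | [c₁] => by simp [FST.run_cons, swapInitStep, qPart]
  | [c₁, c₂] => by
    by_cases h : c₂ = c₁ <;> simp [FST.run_cons, swapInitStep, qPart, h]
  | [c₁, c₂, c₃] => by
    by_cases h : c₂ = c₁
    · subst h
      by_cases h3 : c₃ = c₂
      · simp [FST.run_cons, swapInitStep, qPart, h3]
      · cases c₂ <;> cases c₃ <;> simp [FST.run_cons, swapInitStep, qPart] at h3 ⊢
    · simp [FST.run_cons, swapInitStep, qPart, h]
  | c₁ :: c₂ :: c₃ :: c₄ :: w => by
    by_cases h : c₂ = c₁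
    · subst h
      by_cases h3 : c₃ = c₂
      · subst h3
        by_cases h4 : c₄ = c₃
        · subst h4; simp [FST.run_cons, swapInitStep, qPart, run_q0 w]
        · simp [FST.run_cons, swapInitStep, qPart, h4, run_fin]
      · cases c₂ <;> cases c₃ <;> simp at h3
        · -- c₁ = false, c₃ = true: separator candidate
          cases c₄
          · simp [FST.run_cons, swapInitStep, qPart, run_fin]
          · simp [FST.run_cons, swapInitStep, qPart, run_p0]
        · simp [FST.run_cons, swapInitStep, qPart, run_fin]
    · simp [FST.run_cons, swapInitStep, qPart, h, run_fin]

/-- From `z1` the transducer emits `(z1Part w).map some`. [folklore] -/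
theorem run_z1 (w : List Bool) : (swapInit.run .z1 w).2 = (z1Part w).map some := by
  induction w with
  | nil => rfl
  | cons b w ih =>
    cases b
    · simp [FST.run_cons, swapInitStep, z1Part, run_q0]
    · simpa [FST.run_cons, swapInitStep, z1Part] using ih

/-- **Shape of the output of `swapInit` on every input**: `none`s first, then the payload. [folklore] -/
theorem swapInit_eval (w : List Bool) :
    swapInit.eval w = List.replicate (stage2 w).2 none ++ ((stage2 w).1).map some := by
  have h : ∀ w : List Bool, (swapInit.run .cnt w).2 =
      List.replicate (splitOnes w).1 none ++ (z1Part (splitOnes w).2).map some := by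
    intro w
    induction w with
    | nil => rfl
    | cons b w ih =>
      cases b
      · simp [FST.run_cons, swapInitStep, splitOnes, run_z1]
      · simp [FST.run_cons, swapInitStep, splitOnes, ih, List.replicate_succ]
  have he : swapInit.eval w = (swapInit.run .cnt w).2 := by simp [FST.eval, swapInit]
  rw [he, h w, stage2]

/-- `pPart` on the doubled second component followed by `01`. [folklore] -/
theorem pPart_dup (b : List Bool) : pPart (dup b ++ [false, true]) = (b.flatMap fun c => [true, false, c]) ++ [false] := by
  induction b with
  | nil => simp [dup, pPart]
  | cons c b ih =>
    simp only [dup, List.flatMap_cons, List.cons_append, List.nil_append] at ih ⊢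
    rw [pPart, if_pos rfl, ih]

/-- `qPart` on the recoded pair `⟨⟨a, b⟩, []⟩ = a⁴ 0011 b² 01`. [folklore] -/
theorem qPart_boolPair (a b : List Bool) : qPart (boolPair (boolPair a b) []) = cfg a b [] := by
  induction a with
  | nil =>
    simp only [boolPair, cfg, List.flatMap_nil, List.nil_append, List.flatMap_cons,
      List.cons_append, List.append_nil]
    rw [qPart]
    simp only [Bool.true_eq_false, if_false, and_self, if_true]
    have := pPart_dup b
    simp only [dup] at this
    rw [this]
  | cons c a ih =>
    have hc : boolPair (boolPair (c :: a) b) [] = c :: c :: c :: c :: boolPair (boolPair a b) [] := by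
      simp [boolPair]
    rw [hc, qPart]
    simp [ih, cfg]

/-- On the well-formed input `1ⁿ 0 0 ⟨⟨a, b⟩, []⟩` the decomposition is `(cfg a b [], n)`. [folklore] -/
theorem stage2_hdr (n : ℕ) (a b : List Bool) :
    stage2 (hdr n 0 (boolPair (boolPair a b) [])) = (cfg a b [], n) := by
  simp [stage2, hdr, z1Part, qPart_boolPair]

/-- `stage2` is polynomial-time computable into the input encoding of the iteration combinator. [folklore] -/
theorem polyTimeComputable_swapStage2 :
    PolyTimeComputable (id : List Bool → List Bool)
      (fun q : List Bool × ℕ => List.replicate q.2 none ++ (id q.1).map some) stage2 := by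
  obtain ⟨p, M, hM⟩ := swapInit.polyTimeComputable_eval
  refine ⟨p, M, fun w => ?_⟩
  have h := hM w
  simp only [id, swapInit_eval] at h ⊢
  exact h

/-! ### Stage 3: one moving round, `swapStep` -/

/-- States of `swapStep`: before the first `a`-cell (`s0`), inside it (`s1`), copying the remaining
`a`-cells (`t0 c`, `t1 c`), the second region without carry (`c0`, `c1`, `c2`) and with carry
(`d0 c`, `d1 c`, `d2 c`), the final state. [folklore] -/
inductive S₃
  | s0
  | s1
  | t0 (c : Bool)
  | t1 (c : Bool)
  | c0
  | c1
  | c2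
  | d0 (c : Bool)
  | d1 (c : Bool)
  | d2 (c : Bool)
  | fin
  deriving DecidableEq, Fintype

/-- Transition function of `swapStep`. [folklore] -/
def swapStepStep : S₃ → Bool → S₃ × List Bool
  | .s0, true => (.s1, [])
  | .s0, false => (.c0, [false])
  | .s1, c => (.t0 c, [])
  | .t0 c, true => (.t1 c, [])
  | .t0 c, false => (.d0 c, [false])
  | .t1 c, x => (.t0 c, [true, x])
  | .c0, true => (.c1, [])
  | .c0, false => (.fin, [false])
  | .c1, m => (if m then .c2 else .c2, [true, m])
  | .c2, x => (.c0, [x])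
  | .d0 c, true => (.d1 c, [])
  | .d0 c, false => (.fin, [true, true, c, false])
  | .d1 c, m => (.d2 c, [true, m])
  | .d2 c, x => (.d0 c, [x])
  | .fin, _ => (.fin, [])

/-- One moving round: drop the first `a`-cell and re-insert it, tagged `11`, in front of the end
marker. [folklore] -/
def swapStep : FST S₃ Bool Bool where
  init := .s0
  step := swapStepStep
  front := fun _ => []
  keep := fun _ => true

/-- The transition of `swapStep` (definitional). [folklore] -/
@[simp] theorem swapStep_step (s : S₃) (b : Bool) : swapStep.step s b = swapStepStep s b := rfl

/-- The transduction of `swapStep` is the body emitted from `s0`. [folklore] -/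
@[simp] theorem swapStep_eval_eq (w : List Bool) : swapStep.eval w = (swapStep.run .s0 w).2 := by
  simp [FST.eval, swapStep]

/-- Second region without carry: 3-cells are copied and the end marker closes. [folklore] -/
theorem swapStep_run_c0 (l : List (Bool × Bool)) :
    (swapStep.run .c0 ((l.flatMap fun p => [true, p.1, p.2]) ++ [false])).2 =
      (l.flatMap fun p => [true, p.1, p.2]) ++ [false] := by
  induction l with
  | nil => simp [FST.run_cons, swapStepStep]
  | cons p l ih => cases p with | mk m x => cases m <;> simp [FST.run_cons, swapStepStep, ih]

/-- Second region with carry `c`: 3-cells are copied and `11c` is inserted before the end marker. [folklore] -/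
theorem swapStep_run_d0 (c : Bool) (l : List (Bool × Bool)) :
    (swapStep.run (.d0 c) ((l.flatMap fun p => [true, p.1, p.2]) ++ [false])).2 =
      (l.flatMap fun p => [true, p.1, p.2]) ++ [true, true, c, false] := by
  induction l with
  | nil => simp [FST.run_cons, swapStepStep]
  | cons p l ih => cases p with | mk m x => simp [FST.run_cons, swapStepStep, ih]

/-- The remaining `a`-cells are copied while carrying. [folklore] -/
theorem swapStep_run_t0 (c : Bool) (l w : List Bool) :
    (swapStep.run (.t0 c) ((l.flatMap fun x => [true, x]) ++ false :: w)).2 =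
      (l.flatMap fun x => [true, x]) ++ false :: (swapStep.run (.d0 c) w).2 := by
  induction l with
  | nil => simp [FST.run_cons, swapStepStep]
  | cons x l ih => simp [FST.run_cons, swapStepStep, ih]

/-- The second region of a configuration as a list of tagged cells. [folklore] -/
theorem region_eq (b moved : List Bool) :
    (b.flatMap fun c => [true, false, c]) ++ (moved.flatMap fun c => [true, true, c]) =
      ((b.map fun c => (false, c)) ++ (moved.map fun c => (true, c))).flatMap
        fun p => [true, p.1, p.2] := by
  simp [List.flatMap_append, List.flatMap_map]

/-- **One moving round on a configuration.** [folklore] -/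
theorem swapStep_eval_cfg (rest b moved : List Bool) :
    swapStep.eval (cfg rest b moved) =
      match rest with
      | [] => cfg [] b moved
      | c :: l => cfg l b (moved ++ [c]) := by
  cases rest with
  | nil =>
    rw [swapStep_eval_eq, cfg]
    simp only [List.flatMap_nil, List.nil_append, FST.run_cons, swapStep_step, swapStepStep]
    rw [region_eq, swapStep_run_c0, ← region_eq]
    simp
  | cons c l =>
    rw [swapStep_eval_eq, cfg]
    simp only [List.flatMap_cons, List.cons_append, List.nil_append, FST.run_cons, swapStep_step,
      swapStepStep, swapStep_run_t0]
    rw [region_eq, swapStep_run_d0]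
    simp [cfg, List.flatMap_append, List.flatMap_map]

/-- **`n` moving rounds** move the first `n` symbols. [folklore] -/
theorem swapStep_iterate_cfg (n : ℕ) :
    ∀ rest b moved : List Bool,
      swapStep.eval^[n] (cfg rest b moved) = cfg (rest.drop n) b (moved ++ rest.take n) := by
  induction n with
  | zero => intro rest b moved; simp
  | succ n ih =>
    intro rest b moved
    cases rest with
    | nil => rw [Function.iterate_succ_apply, swapStep_eval_cfg]; simpa using ih [] b moved
    | cons c l =>
      rw [Function.iterate_succ_apply, swapStep_eval_cfg]
      simp only [ih, List.drop_succ_cons, List.take_succ_cons, List.append_assoc,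
        List.singleton_append]

/-- Potential of a state of `swapStep`: pending symbols plus `3` while the insertion of a 3-cell
may still happen (`2` before the carried cell has been read). [folklore] -/
def S₃.pot : S₃ → ℕ
  | .s0 => 2
  | .s1 => 3
  | .t0 _ => 3
  | .t1 _ => 4
  | .c0 => 0
  | .c1 => 1
  | .c2 => 0
  | .d0 _ => 3
  | .d1 _ => 4
  | .d2 _ => 3
  | .fin => 0

/-- Amortised length bound: `|body| ≤ |w| + pot s` from every state `s`. [folklore] -/
theorem swapStep_length_run_le (w : List Bool) :
    ∀ s : S₃, (swapStep.run s w).2.length ≤ w.length + s.pot := by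
  induction w with
  | nil => intro s; simp
  | cons x w ih =>
    intro s
    rcases s with _ | _ | c | c | _ | _ | _ | c | c | c | _ <;> cases x <;>
      simp [FST.run_cons, swapStepStep, S₃.pot] <;>
      first
      | (have := ih .s1; simp [S₃.pot] at this; omega)
      | (have := ih .c0; simp [S₃.pot] at this; omega)
      | (have := ih (.t0 false); simp [S₃.pot] at this; omega)
      | (have := ih (.t0 true); simp [S₃.pot] at this; omega)
      | (have := ih (.t1 c); simp [S₃.pot] at this; omega)
      | (have := ih (.d0 c); simp [S₃.pot] at this; omega)
      | (have := ih (.t0 c); simp [S₃.pot] at this; omega)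
      | (have := ih .c1; simp [S₃.pot] at this; omega)
      | (have := ih .fin; simp [S₃.pot] at this; omega)
      | (have := ih .c2; simp [S₃.pot] at this; omega)
      | (have := ih (.d1 c); simp [S₃.pot] at this; omega)
      | (have := ih (.d2 c); simp [S₃.pot] at this; omega)

/-- `|swapStep w| ≤ |w| + 2` for every input `w` (additive growth, `d = 2`). [folklore] -/
theorem length_swapStep_eval_le (w : List Bool) : (swapStep.eval w).length ≤ w.length + 2 := by
  simpa [S₃.pot] using swapStep_length_run_le w .s0

/-- **Clocked moving is polynomial time.** [Arora–Barak 2009, §1.4.1] [cite: AroraBarakCC2009, §1.4.1] -/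
theorem polyTimeComputable_iterate_swapStep :
    PolyTimeComputable (fun q : List Bool × ℕ => List.replicate q.2 none ++ (id q.1).map some)
      (id : List Bool → List Bool) (fun q => swapStep.eval^[q.2] q.1) :=
  PolyTimeComputable.iterate_of_le_add (ea := (id : List Bool → List Bool)) 2
    (fun w => by simpa using length_swapStep_eval_le w) swapStep.polyTimeComputable_eval

/-! ### Stage 4: decoding, `swapOut` -/

/-- States of `swapOut`: leftover `a`-cells (`g0`, `g1`), the second region before any moved cell
(`h0`, `h1`, `hb`, `hm`), after the first moved cell (`k0`, `k1`, `k2`), final. [folklore] -/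
inductive S₄
  | g0
  | g1
  | h0
  | h1
  | hb
  | hm
  | k0
  | k1
  | k2
  | fin
  deriving DecidableEq, Fintype

/-- Transition function of `swapOut`: `b`-cells `10c ↦ cc`, first moved cell `11c ↦ 01c`, later
moved cells `11c ↦ c` (and `10c ↦ cc`), end marker `0 ↦ 01` if no moved cell was seen. [folklore] -/
def swapOutStep : S₄ → Bool → S₄ × List Bool
  | .g0, true => (.g1, [])
  | .g0, false => (.h0, [])
  | .g1, _ => (.g0, [])
  | .h0, true => (.h1, [])
  | .h0, false => (.fin, [false, true])
  | .h1, false => (.hb, [])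
  | .h1, true => (.hm, [false, true])
  | .hb, c => (.h0, [c, c])
  | .hm, c => (.k0, [c])
  | .k0, true => (.k1, [])
  | .k0, false => (.fin, [])
  | .k1, false => (.k2, [])
  | .k1, true => (.k2, [])
  | .k2, c => (.k0, [c])
  | .fin, _ => (.fin, [])

/-- The decoding transducer `cfg [] b a ↦ ⟨b, a⟩`. [folklore] -/
def swapOut : FST S₄ Bool Bool where
  init := .g0
  step := swapOutStep
  front := fun _ => []
  keep := fun _ => true

/-- The transition of `swapOut` (definitional). [folklore] -/
@[simp] theorem swapOut_step (s : S₄) (b : Bool) : swapOut.step s b = swapOutStep s b := rfl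

/-- After the first moved cell, moved cells contribute their symbol and the end marker nothing. [folklore] -/
theorem swapOut_run_k0 (moved : List Bool) :
    (swapOut.run .k0 ((moved.flatMap fun c => [true, true, c]) ++ [false])).2 = moved := by
  induction moved with
  | nil => simp [FST.run_cons, swapOutStep]
  | cons c l ih => simp [FST.run_cons, swapOutStep, ih]

/-- The `b`-cells are decoded as doubled symbols. [folklore] -/
theorem swapOut_run_h0_b (b w : List Bool) :
    (swapOut.run .h0 ((b.flatMap fun c => [true, false, c]) ++ w)).2 = dup b ++ (swapOut.run .h0 w).2 := by
  induction b with
  | nil => rfl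
  | cons c l ih => simp [FST.run_cons, swapOutStep, ih, dup]

/-- **Decoding a final configuration**: `swapOut (cfg [] b moved) = ⟨b, moved⟩`. [folklore] -/
theorem swapOut_eval_cfg (b moved : List Bool) :
    swapOut.eval (cfg [] b moved) = boolPair b moved := by
  have he : swapOut.eval (cfg [] b moved) = (swapOut.run .g0 (cfg [] b moved)).2 := by
    simp [FST.eval, swapOut]
  rw [he, cfg]
  simp only [List.flatMap_nil, List.nil_append, FST.run_cons, swapOut_step, swapOutStep,
    List.append_assoc]
  rw [swapOut_run_h0_b]
  cases moved with
  | nil => simp [FST.run_cons, swapOutStep, boolPair_eq_dup]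
  | cons c l => simp [FST.run_cons, swapOutStep, swapOut_run_k0, boolPair_eq_dup]

end StrSwap

open StrSwap

/-! ### The swap map -/

/-- **The swap map** `swapFn`, a total string function with `swapFn ⟨a, b⟩ = ⟨b, a⟩`
(`swapFn_boolPair`): end-mark, clock, recode, `|⟨a, b⟩| ≥ |a|` moving rounds, decode.
[Arora–Barak 2009, §1.3] [cite: AroraBarakCC2009, §1.3] -/
noncomputable def swapFn : List Bool → List Bool :=
  swapOut.eval ∘ (fun s : List Bool × ℕ => swapStep.eval^[s.2] s.1) ∘ StrSwap.stage2 ∘ initFn ∘ rePair ∘ dup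

/-- **`swapFn ⟨a, b⟩ = ⟨b, a⟩`.** [Arora–Barak 2009, §1.3] [cite: AroraBarakCC2009, §1.3] -/
theorem swapFn_boolPair (a b : List Bool) : swapFn (boolPair a b) = boolPair b a := by
  simp only [swapFn, Function.comp_apply, rePair_dup, initFn, boolUnpair_boolPair, StrSwap.stage2_hdr,
    swapStep_iterate_cfg, List.nil_append]
  have hlen : a.length ≤ (boolPair a b).length := by rw [length_boolPair]; omega
  rw [List.drop_of_length_le hlen, List.take_of_length_le hlen, swapOut_eval_cfg]

/-- **The swap map is in `FP`.** [Arora–Barak 2009, §1.3, Thm. 2.8 (proof: composition)] [cite: AroraBarakCC2009, §1.3] -/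
theorem swapFn_mem_FP : swapFn ∈ FP :=
  PolyTimeComputable.comp_holds swapOut.polyTimeComputable_eval
    (PolyTimeComputable.comp_holds polyTimeComputable_iterate_swapStep
      (PolyTimeComputable.comp_holds polyTimeComputable_swapStage2
        (PolyTimeComputable.comp_holds initFn_mem_FP
          (PolyTimeComputable.comp_holds rePair_mem_FP dup_mem_FP))))

/-! ### Applying a polynomial-time map to the second component -/

/-- `mapSndFn f = swap ∘ mapFst f ∘ swap`. [Arora–Barak 2009, Thm. 2.8] [cite: AroraBarakCC2009, Thm. 2.8] -/
noncomputable def mapSndFn (f : List Bool → List Bool) : List Bool → List Bool :=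
  swapFn ∘ mapFstFn f ∘ swapFn

/-- **`mapSndFn f ⟨a, b⟩ = ⟨a, f b⟩`.** [Arora–Barak 2009, Thm. 2.8] [cite: AroraBarakCC2009, Thm. 2.8] -/
@[simp] theorem mapSndFn_boolPair (f : List Bool → List Bool) (a b : List Bool) :
    mapSndFn f (boolPair a b) = boolPair a (f b) := by
  simp [mapSndFn, swapFn_boolPair]

/-- **`mapSndFn f ∈ FP` for `f ∈ FP`.** [Arora–Barak 2009, Thm. 2.8] [cite: AroraBarakCC2009, Thm. 2.8] -/
theorem mapSndFn_mem_FP {f : List Bool → List Bool} (hf : f ∈ FP) : mapSndFn f ∈ FP :=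
  comp_mem_FP swapFn_mem_FP (comp_mem_FP (mapFstFn_mem_FP hf) swapFn_mem_FP)

end Literature.Computability.Complexity
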